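import Summits.BirchSwinnertonDyer.BirchSwinnertonDyer.Theorems.ResidualThetaTransportAtTwoSignedMuVanishingAtTwoPlusMultOneOldFamilyEngine
import Summits.BirchSwinnertonDyer.BirchSwinnertonDyer.Theorems.ResidualThetaTransportAtTwoSignedMuVanishingAtTwoPlusMultOneCongruence
import HarnessLib

/-!
# Route `ResidualThetaTransportAtTwo`, crux Kμ⁺ `SignedMuVanishingAtTwoPlus` (stmt-BirchSwinnertonDyer-20689), line
# `birth`, stub `stub_flatMuZeroAtTwo`: the old family for the level pattern `N_W = N₀ · q · ℓ²` (one multiplicative prime `q`,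
# one additive square `ℓ²`), CONSTRUCTED with the engine — `S = {1, q, ℓ², ℓ²q}`, `H = D₁ + D_q + D_{ℓ²} + D_{ℓ²q}`

Cell `bsd-wall`, width seat `bsd-wall-rtt-p4-w2` (g4). THEOREMS ONLY; helper `--supports` the crux; closes nothing. BSD is not proved
by this. The pattern of the habitat⁺ class `157113h1` (`N = 27·11·23²`, anchor `27a1`).

## What is proved
* `heckeT_q_oldFamily_prime_sq` / `heckeT_l_oldFamily_prime_sq` / `heckeT_oldFamily_prime_sq_of_dvd_level`: the `T_p` action on
  `H` at `p = q`, `p = ℓ`, `p ∣ N₀` in the form `T_p H = a • H + 2 • K` with `K` an INTEGER combination of old forms `D_t`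
  (engine rules `heckeT_D_of_not_dvd` / `heckeT_D_of_dvd` / `heckeT_D_of_dvd_level`): at `q`, `a = A q` odd needs `a_q(g)` even;
  at `ℓ`, `a = A ℓ` even needs `a_ℓ(g)` even; at `p ∣ N₀`, `a = A p ≡ a_p(g)`.
* `flatAtTwo_of_namedFacts_of_prime_sq_level`: FLAT at `(W, f)` on the habitat⁺ with `N_W = N₀ q ℓ²` from the four named facts,
  a congruent rational newform `g` of level `N₀` with `a_q(g), a_ℓ(g)` even, `A q` odd, `A ℓ` even, `A p ≡ a_p(g)` for
  `p ∉ {q, ℓ}`, and ONE odd doubled plus symbol of `g`.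
* `flatAtTwo_turnkey_prime_sq_level`: the same with `hcongr` off `N_W` discharged from an equivariant `W[2] ≃+ A'[2]`
  (`…MultOneCongruence`).

References: [AtkinLehner1970] Lemma 15; [DiamondShurman2005] §5.7, Prop. 5.8.5; [Buzzard2000LevelLoweringModTwo] Prop. 2.4;
[DarmonDiamondTaylor1995] Lemma 1.38; [SerreInventiones1972] Prop. 12; [Mazur1978]; [EmertonPollackWeston2006] §4.4.
-/

set_option autoImplicit false
set_option linter.dupNamespace false

noncomputable section

open scoped Classical MatrixGroups ModularForm

open CongruenceSubgroup Field WeierstrassCurve Literature.NumberTheory.EllipticCurves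
  Literature.NumberTheory.EllipticCurves.ModularForms Literature.NumberTheory.EllipticCurves.Rank1Residual
  Literature.NumberTheory.IwasawaTheory Summit.BirchSwinnertonDyer.Rank1Residual.Supersingular
  Summit.BirchSwinnertonDyer.BirchSwinnertonDyer.Theses.ResidualThetaTransportAtTwo

namespace Summit.BirchSwinnertonDyer.BirchSwinnertonDyer.Theorems.SignedMuAtTwo

namespace MultOneDictionary

/-! ## §1. `T_p` on `H = D₁ + D_q + D_{ℓ²} + D_{ℓ²q}` -/

section Hecke

variable {N₀ N : ℕ} [NeZero N₀] [NeZero N] {q ℓ : ℕ} (hq : q.Prime) (hℓ : ℓ.Prime) (hqℓ : q ≠ ℓ)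
  (hqN₀ : ¬ q ∣ N₀) (hℓN₀ : ¬ ℓ ∣ N₀) (hN : N₀ * (q * ℓ ^ 2) = N) (g : CuspForm (Gamma0 N₀) 2) (hg : IsNewform0 g)

include hq hℓ hqℓ hqN₀ hN hg in
/-- **`T_q` on the old family**: with `D_t = degeneracyMap0 N₀ N t 2 g`, `T_q (D₁ + D_q + D_{ℓ²} + D_{ℓ²q}) =
(a_q(g) + q)(D₁ + D_{ℓ²}) − (D_q + D_{ℓ²q})`. [cite: DiamondShurman2005, Prop. 5.2.2 (a), §5.7, Prop. 5.8.5] -/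
theorem heckeT_q_oldFamily_prime_sq [NeZero q] [NeZero (ℓ ^ 2)] [NeZero (ℓ ^ 2 * q)] :
    heckeT (Gamma0 N) 2 q (degeneracyMap0 N₀ N 1 2 g + degeneracyMap0 N₀ N q 2 g + degeneracyMap0 N₀ N (ℓ ^ 2) 2 g +
        degeneracyMap0 N₀ N (ℓ ^ 2 * q) 2 g) =
      (cuspCoeff g q + q) • (degeneracyMap0 N₀ N 1 2 g + degeneracyMap0 N₀ N (ℓ ^ 2) 2 g) -
        (degeneracyMap0 N₀ N q 2 g + degeneracyMap0 N₀ N (ℓ ^ 2 * q) 2 g) := by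
  have h1 : N₀ * 1 ∣ N := ⟨q * ℓ ^ 2, by rw [mul_one, hN]⟩
  have hq' : N₀ * q ∣ N := ⟨ℓ ^ 2, by rw [← hN]; ring⟩
  have hℓ2 : N₀ * ℓ ^ 2 ∣ N := ⟨q, by rw [← hN]; ring⟩
  have hℓ2q : N₀ * (ℓ ^ 2 * q) ∣ N := ⟨1, by rw [← hN]; ring⟩
  have hqN : q ∣ N := ⟨N₀ * ℓ ^ 2, by rw [← hN]; ring⟩
  have hqℓ2 : ¬ q ∣ ℓ ^ 2 := fun h ↦ hqℓ ((Nat.prime_dvd_prime_iff_eq hq hℓ).mp (hq.dvd_of_dvd_pow h))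
  rw [map_add, map_add, map_add,
    heckeT_D_of_not_dvd (N := N) hg hq hqN hqN₀ (t := 1) (tp := q) (by simp [hq.one_lt.ne']) (one_mul q).symm h1 hq',
    heckeT_D_of_dvd (N := N) g hq hqN (t := 1) (tp := q) (one_mul q).symm h1 hq',
    heckeT_D_of_not_dvd (N := N) hg hq hqN hqN₀ (t := ℓ ^ 2) (tp := ℓ ^ 2 * q) hqℓ2 rfl hℓ2 hℓ2q,
    heckeT_D_of_dvd (N := N) g hq hqN (t := ℓ ^ 2) (tp := ℓ ^ 2 * q) rfl hℓ2 hℓ2q]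
  module

include hq hℓ hqℓ hℓN₀ hN hg in
/-- **`T_ℓ` on the old family**: `T_ℓ (D₁ + D_q + D_{ℓ²} + D_{ℓ²q}) = a_ℓ(g)(D₁ + D_q) + (ℓ − 1)(D_ℓ + D_{qℓ})`.
[cite: DiamondShurman2005, Prop. 5.2.2 (a), §5.7, Prop. 5.8.5] -/
theorem heckeT_l_oldFamily_prime_sq [NeZero q] [NeZero ℓ] [NeZero (ℓ ^ 2)] [NeZero (ℓ ^ 2 * q)] [NeZero (q * ℓ)] :
    heckeT (Gamma0 N) 2 ℓ (degeneracyMap0 N₀ N 1 2 g + degeneracyMap0 N₀ N q 2 g + degeneracyMap0 N₀ N (ℓ ^ 2) 2 g +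
        degeneracyMap0 N₀ N (ℓ ^ 2 * q) 2 g) =
      cuspCoeff g ℓ • (degeneracyMap0 N₀ N 1 2 g + degeneracyMap0 N₀ N q 2 g) +
        ((ℓ : ℂ) - 1) • (degeneracyMap0 N₀ N ℓ 2 g + degeneracyMap0 N₀ N (q * ℓ) 2 g) := by
  have h1 : N₀ * 1 ∣ N := ⟨q * ℓ ^ 2, by rw [mul_one, hN]⟩
  have hq' : N₀ * q ∣ N := ⟨ℓ ^ 2, by rw [← hN]; ring⟩
  have hℓ' : N₀ * ℓ ∣ N := ⟨q * ℓ, by rw [← hN]; ring⟩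
  have hqℓ' : N₀ * (q * ℓ) ∣ N := ⟨ℓ, by rw [← hN]; ring⟩
  have hℓ2 : N₀ * ℓ ^ 2 ∣ N := ⟨q, by rw [← hN]; ring⟩
  have hℓ2q : N₀ * (ℓ ^ 2 * q) ∣ N := ⟨1, by rw [← hN]; ring⟩
  have hℓN : ℓ ∣ N := ⟨N₀ * q * ℓ, by rw [← hN]; ring⟩
  have hℓq : ¬ ℓ ∣ q := fun h ↦ hqℓ ((Nat.prime_dvd_prime_iff_eq hℓ hq).mp h).symm
  rw [map_add, map_add, map_add,
    heckeT_D_of_not_dvd (N := N) hg hℓ hℓN hℓN₀ (t := 1) (tp := ℓ) (by simp [hℓ.one_lt.ne']) (one_mul ℓ).symm h1 hℓ',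
    heckeT_D_of_not_dvd (N := N) hg hℓ hℓN hℓN₀ (t := q) (tp := q * ℓ) hℓq rfl hq' hqℓ',
    heckeT_D_of_dvd (N := N) g hℓ hℓN (t := ℓ) (tp := ℓ ^ 2) (sq ℓ) hℓ' hℓ2,
    heckeT_D_of_dvd (N := N) g hℓ hℓN (t := q * ℓ) (tp := ℓ ^ 2 * q) (by ring) hqℓ' hℓ2q]
  module

include hq hℓ hqN₀ hℓN₀ hN hg in
/-- **`T_p` on the old family for `p ∣ N₀`**: `T_p H = a_p(g) H`. [cite: DiamondShurman2005, Prop. 5.2.2 (a), Prop. 5.8.5 and §5.7] -/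
theorem heckeT_oldFamily_prime_sq_of_dvd_level [NeZero q] [NeZero (ℓ ^ 2)] [NeZero (ℓ ^ 2 * q)] {p : ℕ} (hp : p.Prime)
    (hpN₀ : p ∣ N₀) :
    (haveI : NeZero p := ⟨hp.ne_zero⟩; heckeT (Gamma0 N) 2 p (degeneracyMap0 N₀ N 1 2 g + degeneracyMap0 N₀ N q 2 g +
        degeneracyMap0 N₀ N (ℓ ^ 2) 2 g + degeneracyMap0 N₀ N (ℓ ^ 2 * q) 2 g)) =
      cuspCoeff g p • (degeneracyMap0 N₀ N 1 2 g + degeneracyMap0 N₀ N q 2 g + degeneracyMap0 N₀ N (ℓ ^ 2) 2 g +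
        degeneracyMap0 N₀ N (ℓ ^ 2 * q) 2 g) := by
  haveI : NeZero p := ⟨hp.ne_zero⟩
  have h1 : N₀ * 1 ∣ N := ⟨q * ℓ ^ 2, by rw [mul_one, hN]⟩
  have hq' : N₀ * q ∣ N := ⟨ℓ ^ 2, by rw [← hN]; ring⟩
  have hℓ2 : N₀ * ℓ ^ 2 ∣ N := ⟨q, by rw [← hN]; ring⟩
  have hℓ2q : N₀ * (ℓ ^ 2 * q) ∣ N := ⟨1, by rw [← hN]; ring⟩
  have hpq : ¬ p ∣ q := fun h ↦ hqN₀ (((Nat.prime_dvd_prime_iff_eq hp hq).mp h) ▸ hpN₀)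
  have hpℓ : ¬ p ∣ ℓ := fun h ↦ hℓN₀ (((Nat.prime_dvd_prime_iff_eq hp hℓ).mp h) ▸ hpN₀)
  have hp1 : ¬ p ∣ 1 := by simp [hp.one_lt.ne']
  have hpℓ2 : ¬ p ∣ ℓ ^ 2 := fun h ↦ hpℓ (hp.dvd_of_dvd_pow h)
  have hpℓ2q : ¬ p ∣ ℓ ^ 2 * q := fun h ↦ ((Nat.Prime.dvd_mul hp).mp h).elim hpℓ2 hpq
  rw [map_add, map_add, map_add, heckeT_D_of_dvd_level (N := N) hg hp hpN₀ hp1 h1,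
    heckeT_D_of_dvd_level (N := N) hg hp hpN₀ hpq hq', heckeT_D_of_dvd_level (N := N) hg hp hpN₀ hpℓ2 hℓ2,
    heckeT_D_of_dvd_level (N := N) hg hp hpN₀ hpℓ2q hℓ2q, smul_add, smul_add, smul_add]

end Hecke

/-! ## §2. FLAT on the habitat⁺ for `N_W = N₀ · q · ℓ²` -/

section Habitat

variable {W : WeierstrassCurve ℚ} [W.IsElliptic] [W.IsGloballyMinimal]

/-- **FLAT at `(W, f)` for `N_W = N₀ · q · ℓ²`, old family constructed.** `W/ℚ` globally minimal, good supersingular at `2`,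
`a₂(W) = 0`, `Δ_W < 0`, newform `f` (eigenvalues `A p`); `N_W = N₀ q ℓ²` with distinct primes `q, ℓ ∤ N₀`; `g` a normalised
newform of level `N₀` with rational coefficients and eigenvalues `B p`; parities `B q`, `B ℓ`, `A ℓ` even, `A q` odd;
`A p ≡ B p (mod 2)` for every prime `p ∉ {q, ℓ}`; ONE odd `2([b/4^k]⁺_g − [0]⁺_g)`; the four named facts. THEN `2 ∤ L♭` for every
Pollack pair of `f` at `2`. Old family: `S = {1, q, ℓ², ℓ²q}`, `δ_t = Gamma0.degeneracyConj`, `H = D₁ + D_q + D_{ℓ²} + D_{ℓ²q}`;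
`hbad` by the engine `hbad_of_two_smul` from §1. [cite: Buzzard2000LevelLoweringModTwo, Prop. 2.4]
[cite: DarmonDiamondTaylor1995, §1.6 Lemma 1.38] [cite: SerreInventiones1972, §1.11 Prop. 12] [cite: Mazur1978, Thm. 1]
[cite: EmertonPollackWeston2006, §4.4] [cite: DiamondShurman2005, §5.7, Prop. 5.8.5] -/
theorem flatAtTwo_of_namedFacts_of_prime_sq_level (hBuz : buzzard2000_multiplicityOne_gamma0)
    (hSe : serre1972_supersingular_decompositionSubgroup_image) (hSD : heckeSelfDual_torsionBy_J0)
    (hMK : mazurKenku_exists_cyclic_isogeny)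
    (hss : GoodSS W 2) (ha : W.frobeniusTrace 2 = 0) (hΔ : W.Δ < 0) [NeZero (W.conductorNorm ℤ)]
    {f : CuspForm (Gamma0 (W.conductorNorm ℤ)) 2} (hf : IsNewformOf W f)
    (A : ℕ → ℤ) (hA : ∀ p : ℕ, p.Prime → cuspCoeff f p = (A p : ℂ))
    {N₀ q ℓ : ℕ} [NeZero N₀] (hq : q.Prime) (hℓ : ℓ.Prime) (hqℓ : q ≠ ℓ) (hqN₀ : ¬ q ∣ N₀) (hℓN₀ : ¬ ℓ ∣ N₀)
    (hN : N₀ * (q * ℓ ^ 2) = W.conductorNorm ℤ)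
    (g : CuspForm (Gamma0 N₀) 2) (hg : IsNewform0 g) (hQg : coeffField g = ⊥)
    (B : ℕ → ℤ) (hB : ∀ p : ℕ, p.Prime → cuspCoeff g p = (B p : ℂ))
    (hBq : Even (B q)) (hBℓ : Even (B ℓ)) (hAq : Odd (A q)) (hAℓ : Even (A ℓ))
    (hcongr : ∀ p : ℕ, p.Prime → p ≠ q → p ≠ ℓ → ((A p : ℤ) : ZMod 2) = ((B p : ℤ) : ZMod 2))
    (hres : ∃ k : ℕ, 1 ≤ k ∧ ∃ b : ℤ, Odd b ∧ ∃ m : ℤ, Odd m ∧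
      ratPlusSymbol g ((b : ℚ) / 4 ^ k) = ratPlusSymbol g 0 + (m : ℚ) / 2) :
    ∀ Lplus Lminus : IwasawaAlgebra 2, IsPollackPair f 2 Lplus Lminus → ¬ PowerSeries.C (2 : ℤ_[2]) ∣ Lminus := by
  haveI : NeZero q := ⟨hq.ne_zero⟩
  haveI : NeZero ℓ := ⟨hℓ.ne_zero⟩
  haveI : NeZero (ℓ ^ 2) := ⟨pow_ne_zero 2 hℓ.ne_zero⟩
  haveI : NeZero (ℓ ^ 2 * q) := ⟨mul_ne_zero (pow_ne_zero 2 hℓ.ne_zero) hq.ne_zero⟩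
  haveI : NeZero (q * ℓ) := ⟨mul_ne_zero hq.ne_zero hℓ.ne_zero⟩
  have h2N : ¬ 2 ∣ W.conductorNorm ℤ := by
    rw [W.dvd_conductorNorm_iff_not_hasGoodReductionAtPrime 2, not_not]
    exact hss.1
  have hNdvd : ∀ {m : ℕ}, m ∣ q * ℓ ^ 2 → N₀ * m ∣ W.conductorNorm ℤ := fun {m} hm ↦ by
    rw [← hN]; exact Nat.mul_dvd_mul_left N₀ hm
  have h2N₀ : ¬ 2 ∣ N₀ := fun h ↦ h2N (h.trans ⟨q * ℓ ^ 2, hN.symm⟩)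
  have hqodd : Odd q := hq.odd_of_ne_two (by rintro rfl; exact h2N (hNdvd ⟨ℓ ^ 2, rfl⟩ |> (dvd_mul_left 2 N₀).trans))
  have hℓodd : Odd ℓ := hℓ.odd_of_ne_two (by
    rintro rfl; exact h2N ((hNdvd (m := 2) ⟨q * 2, by ring⟩) |> (dvd_mul_left 2 N₀).trans))
  have h1 : N₀ * 1 ∣ W.conductorNorm ℤ := hNdvd (one_dvd _)
  have hq' : N₀ * q ∣ W.conductorNorm ℤ := hNdvd (dvd_mul_right q _)
  have hℓ' : N₀ * ℓ ∣ W.conductorNorm ℤ := hNdvd (Dvd.dvd.mul_left (dvd_pow_self ℓ two_ne_zero) q)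
  have hqℓ' : N₀ * (q * ℓ) ∣ W.conductorNorm ℤ := hNdvd (Nat.mul_dvd_mul_left q (dvd_pow_self ℓ two_ne_zero))
  have hℓ2 : N₀ * ℓ ^ 2 ∣ W.conductorNorm ℤ := hNdvd (dvd_mul_left _ q)
  have hℓ2q : N₀ * (ℓ ^ 2 * q) ∣ W.conductorNorm ℤ := hNdvd ⟨1, by ring⟩
  have hΩg : plusPeriod g ≠ 0 := (IsNewform0.plusPeriod_pos_holds hg hQg).ne'
  have hA2 : A 2 = 0 := by
    have := hA 2 Nat.prime_two
    rw [hf.2 2, W.LFunction_apply_prime_eq_frobeniusTrace 2 hss.1, ha] at this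
    exact_mod_cast this.symm
  have haev : Even (B 2) := by
    by_cases h2q : (2 : ℕ) = q
    · rw [h2q]; exact hBq
    by_cases h2ℓ : (2 : ℕ) = ℓ
    · rw [h2ℓ]; exact hBℓ
    have h := hcongr 2 Nat.prime_two h2q h2ℓ
    rw [hA2, Int.cast_zero] at h
    exact even_iff_two_dvd.mpr ((ZMod.intCast_zmod_eq_zero_iff_dvd _ 2).mp h.symm)
  -- the four old forms, the family and its symbols
  let D₁ := degeneracyMap0 N₀ (W.conductorNorm ℤ) 1 2 g
  let Dq := degeneracyMap0 N₀ (W.conductorNorm ℤ) q 2 g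
  let Dℓ2 := degeneracyMap0 N₀ (W.conductorNorm ℤ) (ℓ ^ 2) 2 g
  let Dℓ2q := degeneracyMap0 N₀ (W.conductorNorm ℤ) (ℓ ^ 2 * q) 2 g
  let H : CuspForm (Gamma0 (W.conductorNorm ℤ)) 2 := D₁ + Dq + Dℓ2 + Dℓ2q
  have hHdef : H = degeneracyMap0 N₀ (W.conductorNorm ℤ) 1 2 g + degeneracyMap0 N₀ (W.conductorNorm ℤ) q 2 g +
      degeneracyMap0 N₀ (W.conductorNorm ℤ) (ℓ ^ 2) 2 g + degeneracyMap0 N₀ (W.conductorNorm ℤ) (ℓ ^ 2 * q) 2 g := rfl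
  have hHint : ∀ γ, ∃ m : ℤ, (cuspSymbol H γ).re = m * (plusPeriod g / 2) :=
    integral_add g (integral_add g (integral_add g (integral_degeneracyMap0 g hΩg h1) (integral_degeneracyMap0 g hΩg hq'))
      (integral_degeneracyMap0 g hΩg hℓ2)) (integral_degeneracyMap0 g hΩg hℓ2q)
  let δ : ℕ → (Gamma0 (W.conductorNorm ℤ) →* Gamma0 N₀) := fun t ↦
    if t = q then Gamma0.degeneracyConj N₀ _ q hq'
    else if t = ℓ ^ 2 then Gamma0.degeneracyConj N₀ _ (ℓ ^ 2) hℓ2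
    else if t = ℓ ^ 2 * q then Gamma0.degeneracyConj N₀ _ (ℓ ^ 2 * q) hℓ2q
    else Gamma0.degeneracyConj N₀ _ 1 h1
  -- distinctness of the four indices
  have hq1 : q ≠ 1 := hq.one_lt.ne'
  have hℓ21 : ℓ ^ 2 ≠ 1 := by
    intro h; nlinarith [hℓ.two_le]
  have hℓ2q1 : ℓ ^ 2 * q ≠ 1 := fun h ↦ hq1 (Nat.eq_one_of_mul_eq_one_left h)
  have hℓ2_q : ℓ ^ 2 ≠ q := fun h ↦ by
    have : ℓ ∣ q := ⟨ℓ, by rw [← h]; ring⟩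
    exact hqℓ ((Nat.prime_dvd_prime_iff_eq hℓ hq).mp this).symm
  have hℓ2q_q : ℓ ^ 2 * q ≠ q := fun h ↦ by
    have : ℓ ^ 2 = 1 := by
      have h' : ℓ ^ 2 * q = 1 * q := by rw [h, one_mul]
      exact Nat.eq_of_mul_eq_mul_right hq.pos h'
    exact hℓ21 this
  have hℓ2q_ℓ2 : ℓ ^ 2 * q ≠ ℓ ^ 2 := fun h ↦ by
    have h' : ℓ ^ 2 * q = ℓ ^ 2 * 1 := by rw [h, mul_one]
    exact hq1 (Nat.eq_of_mul_eq_mul_left (pow_pos hℓ.pos 2) h')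
  have hδ1 : δ 1 = Gamma0.degeneracyConj N₀ _ 1 h1 := by
    simp only [δ, if_neg hq1.symm, if_neg hℓ21.symm, if_neg hℓ2q1.symm]
  have hδq : δ q = Gamma0.degeneracyConj N₀ _ q hq' := by simp only [δ, if_pos rfl]
  have hδℓ2 : δ (ℓ ^ 2) = Gamma0.degeneracyConj N₀ _ (ℓ ^ 2) hℓ2 := by simp [δ, hℓ2_q]
  have hδℓ2q : δ (ℓ ^ 2 * q) = Gamma0.degeneracyConj N₀ _ (ℓ ^ 2 * q) hℓ2q := by simp [δ, hℓ2q_q, hℓ2q_ℓ2]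
  have hHsym : ∀ γ : Gamma0 (W.conductorNorm ℤ), cuspSymbol H γ = ∑ t ∈ ({1, q, ℓ ^ 2, ℓ ^ 2 * q} : Finset ℕ), cuspSymbol g (δ t γ) := by
    intro γ
    rw [Finset.sum_insert (by simp [hq1.symm, hℓ21.symm, hℓ2q1.symm]), Finset.sum_insert (by simp [hℓ2_q.symm, hℓ2q_q.symm]),
      Finset.sum_pair hℓ2q_ℓ2.symm, hδ1, hδq, hδℓ2, hδℓ2q, hHdef, cuspSymbol_add, cuspSymbol_add, cuspSymbol_add,
      cuspSymbol_degeneracyMap0 h1, cuspSymbol_degeneracyMap0 hq', cuspSymbol_degeneracyMap0 hℓ2, cuspSymbol_degeneracyMap0 hℓ2q]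
    ring
  refine flatAtTwo_of_namedFacts hBuz hSe hSD hMK hss ha hΔ hf A hA g hg hQg h2N₀ B hB haev
    (fun p hp hpN ↦ hcongr p hp (by intro h; subst h; exact hpN ((dvd_mul_left _ N₀).trans hq'))
      (by intro h; subst h; exact hpN ((dvd_mul_left _ N₀).trans hℓ')))
    {1, q, ℓ ^ 2, ℓ ^ 2 * q} ⟨1, by simp⟩ (fun t ht ↦ ?_) δ (fun t ht γ ↦ ?_) (fun t ht γ ↦ ?_) (fun t ht γ ↦ ?_)
    (fun t ht γ ↦ ?_) (fun t ht γ ↦ ?_) H hHsym (fun p hp hpN ↦ ?_) (fun p hp hpN γ σ hσ mσ mγ hmσ hmγ ↦ ?_) hres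
  · -- odd indices
    simp only [Finset.mem_insert, Finset.mem_singleton] at ht
    rcases ht with rfl | rfl | rfl | rfl
    exacts [odd_one, hqodd, hℓodd.pow, hℓodd.pow.mul hqodd]
  · simp only [Finset.mem_insert, Finset.mem_singleton] at ht
    rcases ht with rfl | rfl | rfl | rfl
    · rw [hδ1]; rfl
    · rw [hδq]; rfl
    · rw [hδℓ2]; rfl
    · rw [hδℓ2q]; rfl
  · simp only [Finset.mem_insert, Finset.mem_singleton] at ht
    rcases ht with rfl | rfl | rfl | rfl
    · rw [hδ1]; exact Gamma0.degeneracyConjElt_apply_zero_one h1 γ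
    · rw [hδq]; exact Gamma0.degeneracyConjElt_apply_zero_one hq' γ
    · rw [hδℓ2]; exact Gamma0.degeneracyConjElt_apply_zero_one hℓ2 γ
    · rw [hδℓ2q]; exact Gamma0.degeneracyConjElt_apply_zero_one hℓ2q γ
  · simp only [Finset.mem_insert, Finset.mem_singleton] at ht
    rcases ht with rfl | rfl | rfl | rfl
    · rw [hδ1]; rfl
    · rw [hδq]; rfl
    · rw [hδℓ2]; rfl
    · rw [hδℓ2q]; rfl
  · simp only [Finset.mem_insert, Finset.mem_singleton] at ht
    rcases ht with rfl | rfl | rfl | rfl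
    · rw [hδ1]; rfl
    · rw [hδq]; rfl
    · rw [hδℓ2]; rfl
    · rw [hδℓ2q]; rfl
  · -- `t ∣ c`
    have hγ := γ.2
    rw [Gamma0_mem] at hγ
    have hNc : ((W.conductorNorm ℤ : ℕ) : ℤ) ∣ (γ : SL(2, ℤ)) 1 0 := (ZMod.intCast_zmod_eq_zero_iff_dvd _ _).mp hγ
    have key : ∀ {t : ℕ}, N₀ * t ∣ W.conductorNorm ℤ → (t : ℤ) ∣ (γ : SL(2, ℤ)) 1 0 := fun {t} h ↦
      (Int.natCast_dvd_natCast.mpr ((dvd_mul_left t N₀).trans h)).trans hNc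
    simp only [Finset.mem_insert, Finset.mem_singleton] at ht
    rcases ht with rfl | rfl | rfl | rfl
    exacts [key h1, key hq', key hℓ2, key hℓ2q]
  · -- `p ∤ N`
    haveI : NeZero p := ⟨hp.ne_zero⟩
    rw [hHdef, map_add, map_add, map_add, heckeT_D_of_not_dvd_level' hg hp hpN h1, heckeT_D_of_not_dvd_level' hg hp hpN hq',
      heckeT_D_of_not_dvd_level' hg hp hpN hℓ2, heckeT_D_of_not_dvd_level' hg hp hpN hℓ2q, hB p hp, ← smul_add, ← smul_add,
      ← smul_add]
  · -- `hbad` at `p ∣ N`: `p ∣ N₀`, `p = q` or `p = ℓ`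
    haveI : NeZero p := ⟨hp.ne_zero⟩
    have hpcases : p ∣ N₀ ∨ p = q ∨ p = ℓ := by
      rw [← hN] at hpN
      rcases (Nat.Prime.dvd_mul hp).mp hpN with h | h
      · exact Or.inl h
      · rcases (Nat.Prime.dvd_mul hp).mp h with h | h
        · exact Or.inr (Or.inl ((Nat.prime_dvd_prime_iff_eq hp hq).mp h))
        · exact Or.inr (Or.inr ((Nat.prime_dvd_prime_iff_eq hp hℓ).mp (hp.dvd_of_dvd_pow h)))
    rcases hpcases with hpN₀ | rfl | rfl
    · -- `p ∣ N₀`: `T_p H = B p • H = A p • H + 2 • (b • H)`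
      have hpq : p ≠ q := by rintro rfl; exact hqN₀ hpN₀
      have hpℓ : p ≠ ℓ := by rintro rfl; exact hℓN₀ hpN₀
      have h2 : (2 : ℤ) ∣ B p - A p :=
        (ZMod.intCast_eq_intCast_iff_dvd_sub _ _ _).mp (hcongr p hp hpq hpℓ)
      obtain ⟨b, hb⟩ := h2
      refine hbad_of_two_smul g hΩg H ((b : ℂ) • H) (integral_zsmul g hHint b) (A p) ?_ γ σ hσ mσ mγ hmσ hmγ
      rw [hHdef, heckeT_oldFamily_prime_sq_of_dvd_level hq hℓ hqN₀ hℓN₀ hN g hg hp hpN₀, hB p hp, ← hHdef, smul_smul,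
        ← add_smul]
      congr 1
      have : (B p : ℂ) = (A p : ℂ) + 2 * (b : ℂ) := by
        have h' : (B p : ℤ) = A p + 2 * b := by linarith
        exact_mod_cast h'
      rw [this]
    · -- `p = q`
      obtain ⟨b, hb⟩ := hBq
      obtain ⟨c, hc⟩ := hAq
      obtain ⟨r, hr⟩ := hqodd
      refine hbad_of_two_smul g hΩg H
        (((b + r - c : ℤ) : ℂ) • (degeneracyMap0 N₀ (W.conductorNorm ℤ) 1 2 g + degeneracyMap0 N₀ (W.conductorNorm ℤ) (ℓ ^ 2) 2 g) +
          ((-c - 1 : ℤ) : ℂ) • (degeneracyMap0 N₀ (W.conductorNorm ℤ) p 2 g + degeneracyMap0 N₀ (W.conductorNorm ℤ) (ℓ ^ 2 * p) 2 g))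
        (integral_add g (integral_zsmul g (integral_add g (integral_degeneracyMap0 g hΩg h1) (integral_degeneracyMap0 g hΩg hℓ2)) _)
          (integral_zsmul g (integral_add g (integral_degeneracyMap0 g hΩg hq') (integral_degeneracyMap0 g hΩg hℓ2q)) _))
        (A p) ?_ γ σ hσ mσ mγ hmσ hmγ
      rw [hHdef, heckeT_q_oldFamily_prime_sq hq hℓ hqℓ hqN₀ hN g hg, hB p hp]
      have e1 : ((B p : ℤ) : ℂ) = 2 * (b : ℂ) := by rw [hb]; push_cast; ring
      have e2 : ((A p : ℤ) : ℂ) = 2 * (c : ℂ) + 1 := by rw [hc]; push_cast; ring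
      have e3 : ((p : ℕ) : ℂ) = 2 * (r : ℂ) + 1 := by rw [hr]; push_cast; ring
      rw [e1, e2, e3]
      push_cast
      module
    · -- `p = ℓ`
      obtain ⟨b, hb⟩ := hBℓ
      obtain ⟨d, hd⟩ := hAℓ
      obtain ⟨r, hr⟩ := hℓodd
      refine hbad_of_two_smul g hΩg H
        (((b - d : ℤ) : ℂ) • (degeneracyMap0 N₀ (W.conductorNorm ℤ) 1 2 g + degeneracyMap0 N₀ (W.conductorNorm ℤ) q 2 g) +
          ((-d : ℤ) : ℂ) • (degeneracyMap0 N₀ (W.conductorNorm ℤ) (p ^ 2) 2 g + degeneracyMap0 N₀ (W.conductorNorm ℤ) (p ^ 2 * q) 2 g) +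
          ((r : ℤ) : ℂ) • (degeneracyMap0 N₀ (W.conductorNorm ℤ) p 2 g + degeneracyMap0 N₀ (W.conductorNorm ℤ) (q * p) 2 g))
        (integral_add g (integral_add g
          (integral_zsmul g (integral_add g (integral_degeneracyMap0 g hΩg h1) (integral_degeneracyMap0 g hΩg hq')) _)
          (integral_zsmul g (integral_add g (integral_degeneracyMap0 g hΩg hℓ2) (integral_degeneracyMap0 g hΩg hℓ2q)) _))
          (integral_zsmul g (integral_add g (integral_degeneracyMap0 g hΩg hℓ') (integral_degeneracyMap0 g hΩg hqℓ')) _))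
        (A p) ?_ γ σ hσ mσ mγ hmσ hmγ
      rw [hHdef, heckeT_l_oldFamily_prime_sq hq hℓ hqℓ hℓN₀ hN g hg, hB p hp]
      have e1 : ((B p : ℤ) : ℂ) = 2 * (b : ℂ) := by rw [hb]; push_cast; ring
      have e2 : ((A p : ℤ) : ℂ) = 2 * (d : ℂ) := by rw [hd]; push_cast; ring
      have e3 : ((p : ℕ) : ℂ) = 2 * (r : ℂ) + 1 := by rw [hr]; push_cast; ring
      rw [e1, e2, e3]
      push_cast
      module

/-- **Per-class turnkey for `N_W = N₀ · q · ℓ²`.** As `flatAtTwo_of_namedFacts_of_prime_sq_level`, with the congruence off `N_W`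
discharged from an anchor `A'` (newform `g`, `N_{A'} ∣ N_W`) and a Galois-equivariant `W[2] ≃+ A'[2]` (`…MultOneCongruence`); the
remaining parities are `B 2`, `B q`, `B ℓ`, `A ℓ` even, `A q` odd, `A p ≡ B p` at `p ∣ N₀`. [cite: Buzzard2000LevelLoweringModTwo, Prop. 2.4]
[cite: DarmonDiamondTaylor1995, §1.6 Lemma 1.38] [cite: SerreInventiones1972, §1.11 Prop. 12] [cite: Mazur1978, Thm. 1]
[cite: EmertonPollackWeston2006, §4.4] -/
theorem flatAtTwo_turnkey_prime_sq_level (hBuz : buzzard2000_multiplicityOne_gamma0)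
    (hSe : serre1972_supersingular_decompositionSubgroup_image) (hSD : heckeSelfDual_torsionBy_J0)
    (hMK : mazurKenku_exists_cyclic_isogeny)
    (hss : GoodSS W 2) (ha : W.frobeniusTrace 2 = 0) (hΔ : W.Δ < 0) [NeZero (W.conductorNorm ℤ)]
    {f : CuspForm (Gamma0 (W.conductorNorm ℤ)) 2} (hf : IsNewformOf W f)
    (A : ℕ → ℤ) (hA : ∀ p : ℕ, p.Prime → cuspCoeff f p = (A p : ℂ))
    (A' : WeierstrassCurve ℚ) [A'.IsElliptic] (hNA : A'.conductorNorm ℤ ∣ W.conductorNorm ℤ)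
    (e : geomTorsion W (2 : ℕ) ≃+ geomTorsion A' (2 : ℕ))
    (he : ∀ (σ : absoluteGaloisGroup ℚ) (P : geomTorsion W (2 : ℕ)), e (σ • P) = σ • e P)
    {N₀ q ℓ : ℕ} [NeZero N₀] (hq : q.Prime) (hℓ : ℓ.Prime) (hqℓ : q ≠ ℓ) (hqN₀ : ¬ q ∣ N₀) (hℓN₀ : ¬ ℓ ∣ N₀)
    (hN : N₀ * (q * ℓ ^ 2) = W.conductorNorm ℤ)
    (g : CuspForm (Gamma0 N₀) 2) (hg : IsNewformOf A' g)
    (B : ℕ → ℤ) (hB : ∀ p : ℕ, p.Prime → cuspCoeff g p = (B p : ℂ)) (hB2 : Even (B 2))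
    (hBq : Even (B q)) (hBℓ : Even (B ℓ)) (hAq : Odd (A q)) (hAℓ : Even (A ℓ))
    (hcongr₀ : ∀ p : ℕ, p.Prime → p ∣ N₀ → ((A p : ℤ) : ZMod 2) = ((B p : ℤ) : ZMod 2))
    (hres : ∃ k : ℕ, 1 ≤ k ∧ ∃ b : ℤ, Odd b ∧ ∃ m : ℤ, Odd m ∧
      ratPlusSymbol g ((b : ℚ) / 4 ^ k) = ratPlusSymbol g 0 + (m : ℚ) / 2) :
    ∀ Lplus Lminus : IwasawaAlgebra 2, IsPollackPair f 2 Lplus Lminus → ¬ PowerSeries.C (2 : ℤ_[2]) ∣ Lminus := by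
  have hA2 : A 2 = 0 := by
    have := hA 2 Nat.prime_two
    rw [hf.2 2, W.LFunction_apply_prime_eq_frobeniusTrace 2 hss.1, ha] at this
    exact_mod_cast this.symm
  have hgood := eigenvalue_congr_two_of_geomTorsion_equiv W A' e he hNA hf hg A B hA hB (by rw [hA2]; exact Even.zero) hB2
  refine flatAtTwo_of_namedFacts_of_prime_sq_level hBuz hSe hSD hMK hss ha hΔ hf A hA hq hℓ hqℓ hqN₀ hℓN₀ hN g hg.1
    hg.coeffField_eq_bot B hB hBq hBℓ hAq hAℓ (fun p hp hpq hpℓ ↦ ?_) hres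
  by_cases hpN : p ∣ W.conductorNorm ℤ
  · rw [← hN] at hpN
    rcases (Nat.Prime.dvd_mul hp).mp hpN with h | h
    · exact hcongr₀ p hp h
    · rcases (Nat.Prime.dvd_mul hp).mp h with h | h
      · exact absurd ((Nat.prime_dvd_prime_iff_eq hp hq).mp h) hpq
      · exact absurd ((Nat.prime_dvd_prime_iff_eq hp hℓ).mp (hp.dvd_of_dvd_pow h)) hpℓ
  · exact hgood p hp hpN

end Habitat

end MultOneDictionary

end Summit.BirchSwinnertonDyer.BirchSwinnertonDyer.Theorems.SignedMuAtTwo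

end
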